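import Summits.ResolutionOfSingularities.ResolutionOfSingularities.Theorems.PAlterationPalterationThesisPerfectTransfer
import Summits.ResolutionOfSingularities.ResolutionOfSingularities.Theorems.PAlterationPalterationThesisStubResOverOfRegModelAtTmpAt
import Summits.ResolutionOfSingularities.ResolutionOfSingularities.Theorems.PAlterationPalterationThesisStubRegModelAtOfResOver
import Summits.ResolutionOfSingularities.ResolutionOfSingularities.Theorems.PAlterationPalterationThesisStubIsLocallyUniformizableOfRegModelAt
import Summits.ResolutionOfSingularities.ResolutionOfSingularities.Theorems.PAlterationPalterationThesisStubAtomsOfPerfectRes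
import Summits.ResolutionOfSingularities.ResolutionOfSingularities.Theorems.PAlterationPalterationThesisPerfectDisplayC5
import Summits.ResolutionOfSingularities.ResolutionOfSingularities.Theorems.ValuativePatchingReductions
import Summits.ResolutionOfSingularities.ResolutionOfSingularities.Theses.Descent
import HarnessLib

/-!
# Crux `PalterationThesis` (stmt-ResolutionOfSingularities-0552), line `Sketch` rev. c6: the display
# — Zariski's two problems (regular models, two-model patching) over PERFECT fields

Line lead c6 (prover-line-stmt-ResolutionOfSingularities-0552-c6-0), 2026-08-17; route
`ResolutionOfSingularities/pAlteration`, crux `PalterationThesis = ∀ p, PIAlt_p ∧ PICover_p`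
(⟺ summit, `palterationThesis_iff_resolutionOfSingularities`).

Rev. c6 of the skeleton `Cruxes/PalterationThesis/Lines/Sketch.lean` composes the crux through
ZARISKI'S TWO PROBLEMS over each perfect field `K` of prime characteristic:
`RegModel_K` (every function field `F/K` with a proper model has a REGULAR proper model;
Zariski 1944 / Piltant 2013 Thm. 2.4; `ProperModel.RegModel` sliced at `K`) and `TMP_K`
(two-model patching of proper models; Piltant 2013 Prop. 5.1 with `P = P_reg`;
`ProperModel.TwoModelPatching` sliced at `K`), plus item stmt-0549 `DescentPerfectToAll`. The
glue landed in wave 1 (`stub_resOver_of_regModelAt_tmpAt` p145213, `stub_regModelAt_of_resOver`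
p145163, `stub_isLocallyUniformizable_of_regModelAt` p145395). This file records, unconditionally:

* `resOver_iff_regModelAt_and_tmpAt` — over ANY field `K`: Res_K ⟺ RegModel_K ∧ TMP_K (the
  fieldwise form of `ProperModel.resolutionInChar_iff_twoModelPatching_and_regModel`);
* `palterationThesis_iff_zariskiPerfect_and_descent` (registered sub-goal) — the crux ⟺
  (RegModel_K ∧ TMP_K for every perfect `K` of every prime characteristic) ∧ `DescentPerfectToAll`;
* `palterationThesis_iff_zariskiPerfect_and_picover`, `resolutionOfSingularities_iff_zariskiPerfect_and_picover`
  — the same with item stmt-0554 `Picover` in place of stmt-0549, and for the summit;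
* `palterationThesis_of_regModelPerfect_tmpPerfect_descent` / `…_picover` — the rev. c6
  composition by name;
* `regModelAt_iff_luAt_of_tmpAt` — under TMP_K, RegModel_K ⟺ local uniformization over `K`;
* `atoms_of_regModelAt` — RegModel_K alone returns both valuation atoms of rev. c3–c5
  (Temkin_K with `L = F`, RRLU1_K), so rev. c6's stub set is implied by rev. c5's:
  `regModelPerfect_of_temkin2013_luAlphaPTorsor_twoModelPatchingPerfect` (fact `Temkin2013` +
  item 0641 `LuAlphaPTorsor` + TMP over perfect fields ⟹ RegModel over perfect fields).

Nothing here is new mathematics: the residues RegModel_perf, TMP_perf (open in transcendence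
degree ≥ 4) and 0549 (⟸ 0554) remain open.
-/

set_option linter.dupNamespace false

noncomputable section

open CategoryTheory AlgebraicGeometry
open Literature.AlgebraicGeometry.Resolution
open Summit.ResolutionOfSingularities.ResolutionOfSingularities.Theses.PAlteration
open Summit.ResolutionOfSingularities.ResolutionOfSingularities.Theses.Descent (DescentPerfectToAll)
open Summit.ResolutionOfSingularities.ResolutionOfSingularities.Theorems.PalterationThesis.PerfectTransfer
open Summit.ResolutionOfSingularities.ResolutionOfSingularities.Theorems.PalterationThesis.PerfectAtoms
  (stub_atoms_of_perfectRes isLocallyUniformizable_of_resOver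
    hasResolution_perfectField_of_temkin2013_luAlphaPTorsor_twoModelPatchingPerfect)

namespace Summit.ResolutionOfSingularities.ResolutionOfSingularities.Theorems.PalterationThesis.ZariskiPerfect

/-! ## Fieldwise Zariski: Res_K ⟺ RegModel_K ∧ TMP_K -/

/-- **Over ANY field `K`: resolution of every reduced separated `K`-scheme of finite type ⟺
existence of regular proper models ∧ two-model patching over `K`** — the fieldwise form of
`ProperModel.resolutionInChar_iff_twoModelPatching_and_regModel` (`→`: resolve a proper model,
`stub_regModelAt_of_resOver`; resolve the join of two models; `←`: patch any proper model with the
regular one, `stub_resOver_of_regModelAt_tmpAt`). [cite: Piltant2013, Thm. 2.4 and Prop. 5.1] -/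
theorem resOver_iff_regModelAt_and_tmpAt (K : Type) [Field K] :
    (∀ (X : Scheme.{0}) (f : X ⟶ Spec (.of K)),
      IsSeparated f → LocallyOfFiniteType f → QuasiCompact f → IsReduced X →
      Scheme.HasResolution X) ↔
    (∀ (F : Type) [Field F] [Algebra K F] [Algebra.EssFiniteType K F],
      Nonempty (ProperModel K F) → ∃ N : ProperModel K F, Scheme.IsRegular N.X) ∧
    (∀ (F : Type) [Field F] [Algebra K F] [Algebra.EssFiniteType K F],
      ∀ M₁ M₂ : ProperModel K F,
        ∃ (N : ProperModel K F) (φ₁ : N.Hom M₁) (φ₂ : N.Hom M₂), φ₁.RegLe ∧ φ₂.RegLe) := by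
  constructor
  · intro hres
    refine ⟨stub_regModelAt_of_resOver K hres, fun F _ _ _ M₁ M₂ => ?_⟩
    -- resolve the join (as in `ProperModel.twoModelPatching_of_resolutionInChar`)
    obtain ⟨N, φ, hN⟩ := (ProperModel.join M₁ M₂).exists_hom_isRegular_of_hasResolution
      (hres _ (ProperModel.join M₁ M₂).π inferInstance inferInstance inferInstance inferInstance)
    exact ⟨N, φ.comp (ProperModel.joinFst M₁ M₂), φ.comp (ProperModel.joinSnd M₁ M₂),
      fun y _ => hN y, fun y _ => hN y⟩
  · rintro ⟨hR, hT⟩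
    exact stub_resOver_of_regModelAt_tmpAt K hR hT

/-! ## The crux and the summit through Zariski's two problems over perfect fields -/

/-- **The crux ⟺ Zariski's two problems over the perfect fields of every prime characteristic ∧
`DescentPerfectToAll`** (registered display sub-goal of line `Sketch` rev. c6): perfect-field
transfer (`palterationThesis_iff_perfect_and_descent`), the fieldwise sandwich
(`pialtOver_and_picoverOver_iff_perfectField`) and `resOver_iff_regModelAt_and_tmpAt`.
[cite: Piltant2013, Thm. 2.4 and Prop. 5.1] -/
theorem palterationThesis_iff_zariskiPerfect_and_descent :
    PalterationThesis ↔
      (∀ p : ℕ, p.Prime → ∀ (K : Type) [Field K] [CharP K p] [PerfectField K],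
        (∀ (F : Type) [Field F] [Algebra K F] [Algebra.EssFiniteType K F],
          Nonempty (ProperModel K F) → ∃ N : ProperModel K F, Scheme.IsRegular N.X) ∧
        (∀ (F : Type) [Field F] [Algebra K F] [Algebra.EssFiniteType K F],
          ∀ M₁ M₂ : ProperModel K F,
            ∃ (N : ProperModel K F) (φ₁ : N.Hom M₁) (φ₂ : N.Hom M₂), φ₁.RegLe ∧ φ₂.RegLe)) ∧
      DescentPerfectToAll := by
  rw [palterationThesis_iff_perfect_and_descent]
  refine and_congr_left fun _ => forall_congr' fun p => forall_congr' fun hp => ?_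
  refine forall_congr' fun K => forall_congr' fun _ => forall_congr' fun _ =>
    forall_congr' fun _ => ?_
  rw [pialtOver_and_picoverOver_iff_perfectField p hp K]
  exact resOver_iff_regModelAt_and_tmpAt K

/-- **The crux ⟺ Zariski's two problems over perfect fields ∧ `Picover`** (item stmt-0554 in
place of stmt-0549: under resolution over perfect fields the two are equivalent,
`descentPerfectToAll_iff_picover_of_perfectRes`). [cite: Piltant2013, Thm. 2.4 and Prop. 5.1] -/
theorem palterationThesis_iff_zariskiPerfect_and_picover :
    PalterationThesis ↔
      (∀ p : ℕ, p.Prime → ∀ (K : Type) [Field K] [CharP K p] [PerfectField K],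
        (∀ (F : Type) [Field F] [Algebra K F] [Algebra.EssFiniteType K F],
          Nonempty (ProperModel K F) → ∃ N : ProperModel K F, Scheme.IsRegular N.X) ∧
        (∀ (F : Type) [Field F] [Algebra K F] [Algebra.EssFiniteType K F],
          ∀ M₁ M₂ : ProperModel K F,
            ∃ (N : ProperModel K F) (φ₁ : N.Hom M₁) (φ₂ : N.Hom M₂), φ₁.RegLe ∧ φ₂.RegLe)) ∧
      Picover := by
  constructor
  · intro h
    exact ⟨(palterationThesis_iff_zariskiPerfect_and_descent.mp h).1,
      picover_of_palterationThesis h⟩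
  · rintro ⟨hZ, hPc⟩
    have hperf : ∀ p : ℕ, p.Prime → ∀ (K : Type) [Field K] [CharP K p] [PerfectField K]
        (X : Scheme.{0}) (f : X ⟶ Spec (.of K)),
        IsSeparated f → LocallyOfFiniteType f → QuasiCompact f → IsReduced X →
        Scheme.HasResolution X := fun p hp K _ _ _ =>
      (resOver_iff_regModelAt_and_tmpAt K).mpr (hZ p hp K)
    exact palterationThesis_iff_zariskiPerfect_and_descent.mpr
      ⟨hZ, (descentPerfectToAll_iff_picover_of_perfectRes hperf).mpr hPc⟩

/-- **Resolution of singularities in positive characteristic ⟺ Zariski's two problems over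
perfect fields ∧ `Picover`.** [cite: Piltant2013, Thm. 2.4 and Prop. 5.1] -/
theorem resolutionOfSingularities_iff_zariskiPerfect_and_picover :
    _root_.ResolutionOfSingularities ↔
      (∀ p : ℕ, p.Prime → ∀ (K : Type) [Field K] [CharP K p] [PerfectField K],
        (∀ (F : Type) [Field F] [Algebra K F] [Algebra.EssFiniteType K F],
          Nonempty (ProperModel K F) → ∃ N : ProperModel K F, Scheme.IsRegular N.X) ∧
        (∀ (F : Type) [Field F] [Algebra K F] [Algebra.EssFiniteType K F],
          ∀ M₁ M₂ : ProperModel K F,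
            ∃ (N : ProperModel K F) (φ₁ : N.Hom M₁) (φ₂ : N.Hom M₂), φ₁.RegLe ∧ φ₂.RegLe)) ∧
      Picover :=
  palterationThesis_iff_resolutionOfSingularities.symm.trans
    palterationThesis_iff_zariskiPerfect_and_picover

/-- **The rev. c6 composition by name**: the crux from regular proper models over perfect
fields, two-model patching over perfect fields and `DescentPerfectToAll` (item stmt-0549).
[cite: Piltant2013, Thm. 2.4 and Prop. 5.1] -/
theorem palterationThesis_of_regModelPerfect_tmpPerfect_descent
    (hR : ∀ p : ℕ, p.Prime → ∀ (K : Type) [Field K] [CharP K p] [PerfectField K]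
      (F : Type) [Field F] [Algebra K F] [Algebra.EssFiniteType K F],
      Nonempty (ProperModel K F) → ∃ N : ProperModel K F, Scheme.IsRegular N.X)
    (hT : ∀ p : ℕ, p.Prime → ∀ (K : Type) [Field K] [CharP K p] [PerfectField K]
      (F : Type) [Field F] [Algebra K F] [Algebra.EssFiniteType K F],
      ∀ M₁ M₂ : ProperModel K F,
        ∃ (N : ProperModel K F) (φ₁ : N.Hom M₁) (φ₂ : N.Hom M₂), φ₁.RegLe ∧ φ₂.RegLe)
    (hD : DescentPerfectToAll) : PalterationThesis :=
  palterationThesis_iff_zariskiPerfect_and_descent.mpr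
    ⟨fun p hp K _ _ _ => ⟨hR p hp K, hT p hp K⟩, hD⟩

/-- The same with item stmt-0554 `Picover` in place of stmt-0549.
[cite: Piltant2013, Thm. 2.4 and Prop. 5.1] -/
theorem palterationThesis_of_regModelPerfect_tmpPerfect_picover
    (hR : ∀ p : ℕ, p.Prime → ∀ (K : Type) [Field K] [CharP K p] [PerfectField K]
      (F : Type) [Field F] [Algebra K F] [Algebra.EssFiniteType K F],
      Nonempty (ProperModel K F) → ∃ N : ProperModel K F, Scheme.IsRegular N.X)
    (hT : ∀ p : ℕ, p.Prime → ∀ (K : Type) [Field K] [CharP K p] [PerfectField K]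
      (F : Type) [Field F] [Algebra K F] [Algebra.EssFiniteType K F],
      ∀ M₁ M₂ : ProperModel K F,
        ∃ (N : ProperModel K F) (φ₁ : N.Hom M₁) (φ₂ : N.Hom M₂), φ₁.RegLe ∧ φ₂.RegLe)
    (hPc : Picover) : PalterationThesis :=
  palterationThesis_iff_zariskiPerfect_and_picover.mpr
    ⟨fun p hp K _ _ _ => ⟨hR p hp K, hT p hp K⟩, hPc⟩

/-! ## Position of the new residue `RegModel_K` among the earlier atoms -/

/-- **Under two-model patching over `K`, Zariski's `RegModel_K` and local uniformization over
`K` are EQUIVALENT** (`→`: a regular proper model uniformizes every valuation,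
`stub_isLocallyUniformizable_of_regModelAt`; `←`: Zariski's resolving system
`resolutionOverUpToDim_of_properPatching_of_lu` gives resolution over `K`, then resolve any
proper model, `stub_regModelAt_of_resOver`). [cite: Piltant2013, Prop. 5.1 and Cor. 5.7] -/
theorem regModelAt_iff_luAt_of_tmpAt (K : Type) [Field K]
    (hT : ∀ (F : Type) [Field F] [Algebra K F] [Algebra.EssFiniteType K F],
      ∀ M₁ M₂ : ProperModel K F,
        ∃ (N : ProperModel K F) (φ₁ : N.Hom M₁) (φ₂ : N.Hom M₂), φ₁.RegLe ∧ φ₂.RegLe) :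
    (∀ (F : Type) [Field F] [Algebra K F] [Algebra.EssFiniteType K F],
      Nonempty (ProperModel K F) → ∃ N : ProperModel K F, Scheme.IsRegular N.X) ↔
    (∀ (F : Type) [Field F] [Algebra K F], (⊤ : IntermediateField K F).FG →
      ∀ O : ValuationSubring F, (∀ c : K, algebraMap K F c ∈ O) →
        IsLocallyUniformizable K F O) := by
  refine ⟨fun hR F _ _ hFfg O hO => stub_isLocallyUniformizable_of_regModelAt K hR F hFfg O hO,
    fun hLU => stub_regModelAt_of_resOver K fun X f hs hl hq hr => ?_⟩
  haveI := hl
  haveI := hq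
  haveI : CompactSpace X := QuasiCompact.compactSpace_of_compactSpace f
  obtain ⟨d, hd⟩ := exists_topologicalKrullDim_le_of_locallyOfFiniteType f
  exact resolutionOverUpToDim_of_properPatching_of_lu hT
    (fun F _ _ hFfg O hO => hLU F hFfg O hO) d X f hs hl hq hr hd

/-- **`RegModel_K` alone returns both valuation atoms of rev. c3–c5 over `K`**: Temkin's
conclusion with `L := F` (a regular proper model uniformizes every valuation ring over `K`) and
`RRLU1_K` (uniformize the trace `O ∩ F` outright). [folklore] -/
theorem atoms_of_regModelAt (p : ℕ) (K : Type) [Field K]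
    (hR : ∀ (F : Type) [Field F] [Algebra K F] [Algebra.EssFiniteType K F],
      Nonempty (ProperModel K F) → ∃ N : ProperModel K F, Scheme.IsRegular N.X) :
    (∀ (F : Type) [Field F] [Algebra K F], (⊤ : IntermediateField K F).FG →
      ∀ O : ValuationSubring F, (∀ c : K, algebraMap K F c ∈ O) →
        ∃ (L : Type) (_ : Field L) (_ : Algebra F L) (_ : Algebra K L) (_ : IsScalarTower K F L),
          FiniteDimensional F L ∧ IsPurelyInseparable F L ∧
          ∃ O' : ValuationSubring L, O'.comap (algebraMap F L) = O ∧
            IsLocallyUniformizable K L O') ∧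
    (∀ (F L : Type) [Field F] [Field L] [Algebra K F] [Algebra F L] [Algebra K L]
      [IsScalarTower K F L], (⊤ : IntermediateField K F).FG → IsPurelyInseparable F L →
      (∃ y : L, y ^ p ∈ (algebraMap F L).range ∧ IntermediateField.adjoin F {y} = ⊤) →
      ∀ B : Subalgebra K L, B.FG → IsFractionRing B L → IsRegularRing B →
      ∀ O : ValuationSubring L, B.toSubring ≤ O.toSubring →
        IsLocallyUniformizable K F (O.comap (algebraMap F L))) := by
  refine ⟨fun F _ _ hFfg O hO => ?_, ?_⟩
  · refine ⟨F, inferInstance, inferInstance, inferInstance, inferInstance, inferInstance,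
      inferInstance, O, ?_, stub_isLocallyUniformizable_of_regModelAt K hR F hFfg O hO⟩
    ext x
    simp
  · intro F L _ _ _ _ _ _ hFfg _hpi _hy B _hBfg _hBfr _hBreg O hBO
    refine stub_isLocallyUniformizable_of_regModelAt K hR F hFfg (O.comap (algebraMap F L))
      fun c => ?_
    change algebraMap F L (algebraMap K F c) ∈ O
    rw [← IsScalarTower.algebraMap_apply]
    exact hBO (B.algebraMap_mem c)

/-- **Rev. c6 is dominated by rev. c5**: the named fact `Temkin2013`, route Valuative's crux
`LuAlphaPTorsor` (item stmt-0641) at `p` and two-model patching over the perfect fields of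
characteristic `p` give `RegModel_K` over every perfect `K` of characteristic `p` (through
resolution over `K`, `hasResolution_perfectField_of_temkin2013_luAlphaPTorsor_twoModelPatchingPerfect`,
then resolve any proper model). [cite: Temkin2013, Thm. 1.3.2 and Rem. 1.3.5 (i)–(ii); Piltant2013, Prop. 5.1] -/
theorem regModelPerfect_of_temkin2013_luAlphaPTorsor_twoModelPatchingPerfect
    (hTk : Temkin2013.{0}) {p : ℕ} [Fact p.Prime]
    (hLu : ∀ (k M : Type) [Field k] [CharP k p] [Field M] [Algebra k M] (O : ValuationSubring M)
      (A₀ : Subalgebra k M) (h₀ : A₀.toSubring ≤ O.toSubring) (t : M), A₀.FG → t ^ p ∈ A₀ →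
      IsFractionRing (Algebra.adjoin k (insert t (A₀ : Set M))) M →
      IsRegularLocalRing (Localization.AtPrime
        (Ideal.comap (Subring.inclusion h₀) (IsLocalRing.maximalIdeal O))) →
      ∃ (A : Subalgebra k M) (h : A.toSubring ≤ O.toSubring), A₀ ≤ A ∧ t ∈ A ∧ A.FG ∧
        IsFractionRing A M ∧
        IsRegularLocalRing (Localization.AtPrime
          (Ideal.comap (Subring.inclusion h) (IsLocalRing.maximalIdeal O))))
    (hZ : ∀ (k : Type) [Field k] [CharP k p] [PerfectField k] (K : Type) [Field K] [Algebra k K]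
      [Algebra.EssFiniteType k K], ∀ M₁ M₂ : ProperModel k K,
        ∃ (N : ProperModel k K) (φ₁ : N.Hom M₁) (φ₂ : N.Hom M₂), φ₁.RegLe ∧ φ₂.RegLe)
    (K : Type) [Field K] [CharP K p] [PerfectField K] :
    ∀ (F : Type) [Field F] [Algebra K F] [Algebra.EssFiniteType K F],
      Nonempty (ProperModel K F) → ∃ N : ProperModel K F, Scheme.IsRegular N.X :=
  stub_regModelAt_of_resOver K fun X f hs hl hq hr => by
    haveI := hs; haveI := hl; haveI := hq; haveI := hr
    exact hasResolution_perfectField_of_temkin2013_luAlphaPTorsor_twoModelPatchingPerfect hTk hLu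
      hZ K X f

end Summit.ResolutionOfSingularities.ResolutionOfSingularities.Theorems.PalterationThesis.ZariskiPerfect

end
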